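import Summits.PneNP.PneNP.Theorems.MonotoneContinuation.Negative.ClosenessLoadBearing
import Summits.PneNP.PneNP.Theorems.MonotoneContinuation.Negative.SparseParity

/-!
# `MonotoneContinuation` (stmt-PneNP-18471) — negative-side lemmas IV-B: the closeness hypothesis is load-bearing at EVERY `k ≥ 3`

`ClosenessLoadBearing.lean` refutes MC-minus-its-hypothesis with the `k = 3` witness (star of a vertex at `p_c = 1/n`); since MC
quantifies over all `k` internally that suffices logically. This file adds robustness against restating MC for ONE fixed clique
size: at `p_c(k) = n^{-2/(k-1)}` take ANY set `T` of `t = ⌊1/p_c⌋` edges (`t·p_c ∈ [7/8, 1]`); the parity of `#(x ∩ T)` is a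
`B₂`-circuit with `t + 1 ≤ n²` gates, its slice transport moves by `≤ 10 m^{-1/4}` (`eventually_local_parity_stability`: part A with
`#T·2m^{3/4}/C(n,2) ≤ 2m^{-1/4}`), and every monotone `F` is `≥ 1/9`-far from it (`SparseParity.lean`). Hence
`eventually_parityOn_witness` (one exponent `c₀ + 3` for all `k`, distance `≥ 1/12`) and the per-`k` headline theorems
`monotoneContinuation_false_without_closeness_at`, `not_transportNearMonotone_at` (`η = ε = 1/24`).

Work file `Summits/PneNP/PneNP/Cruxes/MonotoneContinuation/Disproof.lean`; refuter seat refuter-cdisprove-stmt-PneNP-18471-0, 2026-08-17.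
-/

set_option linter.dupNamespace false

namespace Summit.PneNP.PneNP.Theorems.MonotoneContinuation.Negative

open Literature.Computability.Complexity hiding supp mem_supp
open Finset hiding slice
open Filter hiding mem_sdiff
open Classical
open Summit.PneNP.PneNP.Theorems.ConstantBand.Negative (Edge thr Central central_thr slice)
open Summit.PneNP.PneNP.Theorems.SliceACZero.Negative (supp mem_supp card_supp supp_injective supp_indicator)
open Summit.PneNP.PneNP.Theorems.SingleThreshold.Negative (pc pc_nonneg pc_le_one gnpProb_and_eq_mul gnpProb_forall_off)
open Summit.PneNP.PneNP.Theorems.SliceTargetSplit (Comp nbhd mem_nbhd transport ind l1 nbhdCard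
  ind_nonneg ind_le_one l1_triangle l1_eq_sum_slices)
open Summit.PneNP.PneNP.Theorems (binomialWeight_sum_range binomialWeight_nonneg binomialWeight_tail_le card_slice
  eventually_window tendsto_mean central_add_le)
open Summit.PneNP.PneNP.Theorems.SliceTarget.Negative (eventually_central_pos_lt eventually_monotonization_small)

noncomputable section

variable {n : ℕ}
/-- **Eventually, the transport moves a sparse parity by at most `τ`**: for every `k ≥ 3`, eventually in `n`, for every edge set
`T` with `#T·p_c ≤ 1` and every central `j`, `‖T_j𝟙[π_T] − 𝟙[π_T]‖_{L¹(G(n,p_c))} ≤ τ` (part A: `#T·2m^{3/4}/C(n,2) ≤ 2m^{-1/4}` since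
`#T ≤ 1/p_c ≤ C(n,2)/m`, and Chebyshev `≤ 8m^{-1/2}`). [folklore] -/
theorem eventually_local_parity_stability {k : ℕ} (hk : 3 ≤ k) {τ : ℝ} (hτ : 0 < τ) :
    ∀ᶠ n : ℕ in atTop, ∀ T : Finset (Edge n), (#T : ℝ) * pc n k ≤ 1 → ∀ j : ℕ, Central k n j →
      l1 n (pc n k) (transport j (ind (parityOn T))) (ind (parityOn T)) ≤ τ := by
  have hm : Tendsto (fun n : ℕ => (thr k n : ℝ)) atTop atTop :=
    tendsto_natCast_atTop_atTop.comp (tendsto_nat_floor_atTop.comp (tendsto_mean hk))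
  have hA : Tendsto (fun n : ℕ => (thr k n : ℝ) ^ ((1 : ℝ) / 4)) atTop atTop :=
    (tendsto_rpow_atTop (by norm_num)).comp hm
  filter_upwards [eventually_window hk 0, hA.eventually_ge_atTop (max 2 (10 / τ))] with n hwin hAge T hT j hj
  obtain ⟨hp0, hp8, h34, -, hwin5⟩ := hwin
  have hp1 : pc n k ≤ 1 := by linarith
  have hjN : j ≤ n.choose 2 := by simpa using central_add_le (w := 0) hp0 hp8 hwin5 hj
  set N := n.choose 2 with hNdef
  set m : ℝ := (thr k n : ℝ) with hmdef
  set A : ℝ := m ^ ((1 : ℝ) / 4) with hAdef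
  set R : ℝ := m ^ ((3 : ℝ) / 4) with hRdef
  have hm0 : 0 ≤ m := Nat.cast_nonneg _
  have hA2 : 2 ≤ A := le_trans (le_max_left _ _) hAge
  have hAτ : 10 / τ ≤ A := le_trans (le_max_right _ _) hAge
  have hA0 : 0 < A := by linarith
  have hA1 : 1 ≤ A := by linarith
  have hmA : m = A ^ 4 := by rw [hAdef, ← Real.rpow_natCast, ← Real.rpow_mul hm0]; norm_num
  have hRA : R = A ^ 3 := by rw [hRdef, hAdef, ← Real.rpow_natCast, ← Real.rpow_mul hm0]; norm_num
  have hR2 : 2 ≤ R := h34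
  have hR0 : 0 < R := by linarith
  have hmpos : 0 < m := by rw [hmA]; positivity
  have hμ0 : 0 ≤ (N : ℝ) * pc n k := mul_nonneg (Nat.cast_nonneg _) hp0.le
  have hmμ : m ≤ (N : ℝ) * pc n k := Nat.floor_le hμ0
  have hμm : (N : ℝ) * pc n k < m + 1 := Nat.lt_floor_add_one _
  have hmain := l1_transport_local_le (parityOn_local T) hp0.le hp1 hjN
    (fun i : ℕ => |(i : ℝ) - m| ≤ R) (by linarith : (0 : ℝ) ≤ 2 * R) (half_pos hR0)
    (fun i hi => by
      calc |(i : ℝ) - j| ≤ |(i : ℝ) - m| + |(m : ℝ) - j| := abs_sub_le _ _ _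
        _ ≤ R + R := add_le_add hi (by rw [abs_sub_comm]; exact hj)
        _ = 2 * R := by ring)
    (fun i _ hi => by
      push Not at hi
      have h1 : |(i : ℝ) - m| ≤ |(i : ℝ) - (N : ℝ) * pc n k| + |(N : ℝ) * pc n k - m| := abs_sub_le _ _ _
      have h2 : |(N : ℝ) * pc n k - m| < 1 := by
        rw [abs_lt]; constructor <;> linarith
      linarith)
  refine hmain.trans ?_
  have hNpos : (0 : ℝ) < N := by
    by_contra h
    push Not at h
    have : (N : ℝ) * pc n k ≤ 0 := mul_nonpos_of_nonpos_of_nonneg h hp0.le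
    linarith
  -- `#T·2R/N ≤ 2R/(N p) ≤ 2R/m = 2/A`
  have hterm1 : (#T : ℝ) * (2 * R) / (N : ℝ) ≤ 2 / A := by
    rw [div_le_div_iff₀ hNpos hA0, hRA]
    have hTN : (#T : ℝ) * m ≤ N := by
      calc (#T : ℝ) * m ≤ #T * ((N : ℝ) * pc n k) := mul_le_mul_of_nonneg_left hmμ (Nat.cast_nonneg _)
        _ = (#T : ℝ) * pc n k * N := by ring
        _ ≤ 1 * N := mul_le_mul_of_nonneg_right hT (Nat.cast_nonneg _)
        _ = N := one_mul _
    have : (#T : ℝ) * (2 * A ^ 3) * A = 2 * (#T * m) := by rw [hmA]; ring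
    nlinarith [this, hTN]
  have hNp : (N : ℝ) * pc n k * (1 - pc n k) ≤ m + 1 := by
    have : (N : ℝ) * pc n k * (1 - pc n k) ≤ (N : ℝ) * pc n k := mul_le_of_le_one_right hμ0 (by linarith)
    linarith
  have hterm2 : (N : ℝ) * pc n k * (1 - pc n k) / (R / 2) ^ 2 ≤ 8 / A := by
    have hR2pos : 0 < (R / 2) ^ 2 := by positivity
    rw [div_le_div_iff₀ hR2pos hA0]
    have hstep : (m + 1) * A ≤ 8 * (R / 2) ^ 2 := by rw [hRA, hmA]; exact numerics_aux hA1
    calc (N : ℝ) * pc n k * (1 - pc n k) * A ≤ (m + 1) * A := mul_le_mul_of_nonneg_right hNp hA0.le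
      _ ≤ 8 * (R / 2) ^ 2 := hstep
  have hsum : 2 / A + 8 / A ≤ τ := by
    rw [← add_div, div_le_iff₀ hA0]
    rw [div_le_iff₀ hτ] at hAτ
    linarith
  linarith [hterm1, hterm2, hsum]

/-- **The sparse-parity witness at every `k ≥ 3`** (one exponent `c_w = c₀ + 3` for all `k`): eventually in `n`, for EVERY central
`j`, Berkowitz's monotonization of the XOR chain of a `⌊1/p_c⌋`-subset of edges is a `{∧₂,∨₂}`-circuit with `≤ n^{c_w}` gates whose
slice-`j` transport is `≥ 1/12`-far in `L¹(G(n,p_c))` from every monotone Boolean function. [folklore] -/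
theorem eventually_parityOn_witness :
    ∃ cw : ℕ, ∀ k : ℕ, 3 ≤ k → ∀ᶠ n : ℕ in atTop, ∀ j : ℕ, Central k n j → ∃ C : Circuit (Edge n), C.IsOver monotoneBasis ∧
      C.size ≤ n ^ cw ∧ ∀ F : (Edge n → Bool) → Bool, Monotone F →
        (1 / 12 : ℝ) ≤ l1 n (pc n k) (ind F) (transport j (ind C.eval)) := by
  obtain ⟨c₀, hc₀⟩ := Summit.PneNP.PneNP.Theorems.sliceMonotonization_proof
  refine ⟨2 + c₀ + 1, fun k hk => ?_⟩
  filter_upwards [eventually_central_pos_lt hk, eventually_monotonization_small 2 c₀, eventually_ge_atTop 2,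
    eventually_window hk 0, eventually_local_parity_stability hk (show (0 : ℝ) < 1 / 36 by norm_num)]
    with n hcen hsm hn2 hwin hstab j hj
  obtain ⟨hp0, hp8, h34, -, -⟩ := hwin
  obtain ⟨hj0, hjN⟩ := hcen j hj
  set p : ℝ := pc n k with hp
  set N := n.choose 2 with hNdef
  have hp1 : p < 1 := by linarith
  -- the edge set: any `t = ⌊1/p⌋` edges
  set t : ℕ := ⌊p⁻¹⌋₊ with htdef
  have hpinv : 8 ≤ p⁻¹ := by
    rw [le_inv_comm₀ (by norm_num) hp0]; linarith
  have htle : (t : ℝ) ≤ p⁻¹ := Nat.floor_le (by positivity)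
  have htlt : p⁻¹ < t + 1 := Nat.lt_floor_add_one _
  have ht8 : 8 ≤ t := Nat.le_floor (by exact_mod_cast hpinv)
  have htp1 : (t : ℝ) * p ≤ 1 := by
    calc (t : ℝ) * p ≤ p⁻¹ * p := mul_le_mul_of_nonneg_right htle hp0.le
      _ = 1 := inv_mul_cancel₀ hp0.ne'
  have htp7 : (7 / 8 : ℝ) ≤ t * p := by
    have : 1 - p < (t : ℝ) * p := by
      have h := mul_lt_mul_of_pos_right htlt hp0
      rw [inv_mul_cancel₀ hp0.ne'] at h
      linarith
    linarith
  -- `t ≤ N` because `N·p ≥ m ≥ 1`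
  have hμ0 : 0 ≤ (N : ℝ) * p := mul_nonneg (Nat.cast_nonneg _) hp0.le
  have hmμ : (thr k n : ℝ) ≤ (N : ℝ) * p := Nat.floor_le hμ0
  have hm1 : (1 : ℝ) ≤ thr k n := by
    by_contra h
    push Not at h
    have h0 : (thr k n : ℝ) ^ ((3 : ℝ) / 4) ≤ 1 :=
      Real.rpow_le_one (Nat.cast_nonneg _) h.le (by norm_num)
    linarith
  have htN : t ≤ N := by
    have : (t : ℝ) ≤ N := by
      calc (t : ℝ) ≤ p⁻¹ := htle
        _ ≤ N := by
            rw [inv_le_iff_one_le_mul₀ hp0]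
            exact hm1.trans hmμ
    exact_mod_cast this
  obtain ⟨T, -, hTcard⟩ := Finset.exists_subset_card_eq (s := (univ : Finset (Edge n)))
    (show t ≤ #(univ : Finset (Edge n)) by rw [card_univ, card_edgeSet_top_fin]; exact htN)
  -- the circuit
  obtain ⟨D, hDB, hDs, hDe⟩ := exists_B2_parityOn T
  obtain ⟨C, hCB, hCs, hCe⟩ := hc₀ n j D hDB hj0 hjN
  have hsize : C.size ≤ n ^ (2 + c₀ + 1) := by
    have hNn : N + 1 ≤ n ^ 2 := by
      rw [hNdef, Nat.choose_two_right, pow_two]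
      have h1 : n * (n - 1) / 2 ≤ n * (n - 1) := Nat.div_le_self _ _
      have h2 : n * (n - 1) + 1 ≤ n * n := by
        have : n * (n - 1) + n = n * n := by
          rw [← Nat.mul_succ, Nat.succ_eq_add_one, Nat.sub_add_cancel (by omega)]
        omega
      omega
    have hD2 : D.size ≤ n ^ 2 := by rw [hTcard] at hDs; omega
    have : C.size ≤ c₀ * (n ^ 2 + n ^ c₀) := hCs.trans (Nat.mul_le_mul_left _ (Nat.add_le_add_right hD2 _))
    omega
  have htr : transport j (ind C.eval) = transport j (ind (parityOn T)) := by
    funext y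
    unfold transport
    rw [sum_congr rfl fun x hx => show ind C.eval x = ind (parityOn T) x by
      simp only [ind, hCe x (mem_nbhd.1 hx).1, hDe x]]
  refine ⟨C, hCB, hsize, fun F hF => ?_⟩
  rw [htr]
  have ht2 : 2 ≤ #T := by rw [hTcard]; omega
  have hTp : (#T : ℝ) * p ≤ 1 := by rw [hTcard]; exact htp1
  have hTp7 : (7 / 8 : ℝ) ≤ #T * p := by rw [hTcard]; exact htp7
  have hfar : (1 / 9 : ℝ) ≤ l1 n p (ind F) (ind (parityOn T)) := l1_monotone_parityOn_ge hp0 hp8 T ht2 hTp hTp7 F hF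
  have hst := hstab T hTp j hj
  have htri := l1_triangle hp0.le hp1.le (ind F) (transport j (ind (parityOn T))) (ind (parityOn T))
  linarith

/-- **Per-`k` load-bearing**: for EVERY fixed `k ≥ 3`, MC restricted to that `k` with the closeness hypothesis dropped is false
(`η = 1/24`). A planner who restates MC for a single clique size still cannot drop the hypothesis. [folklore] -/
theorem monotoneContinuation_false_without_closeness_at {k : ℕ} (hk : 3 ≤ k) :
    ¬ ∀ c : ℕ, ∃ c' : ℕ, ∀ η : ℝ, 0 < η → ∀ᶠ n : ℕ in atTop, ∀ j : ℕ, Central k n j →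
      ∀ C : Circuit (Edge n), C.IsOver monotoneBasis → C.size ≤ n ^ c →
        ∃ C' : Circuit (Edge n), C'.IsOver monotoneBasis ∧ C'.size ≤ n ^ c' ∧
          l1 n (pc n k) (ind C'.eval) (transport j (ind C.eval)) ≤ η := by
  intro h
  obtain ⟨cw, hw⟩ := eventually_parityOn_witness
  obtain ⟨c', hc'⟩ := h cw
  have H := hc' (1 / 24) (by norm_num)
  obtain ⟨n, hn, hwn⟩ := (H.and (hw k hk)).exists
  obtain ⟨C, hC, hCs, hfar⟩ := hwn (thr k n) (central_thr k n)
  obtain ⟨C', hC', -, hd'⟩ := hn (thr k n) (central_thr k n) C hC hCs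
  have := hfar C'.eval (Circuit.monotone_eval_of_isOver_monotoneBasis C' hC')
  linarith

/-- **Per-`k` failure of the strengthening**: for EVERY fixed `k ≥ 3`, it is not the case that the slice transports of all small
`{∧₂,∨₂}`-circuits are eventually `ε`-close to monotone Boolean functions (`ε = 1/24`). [folklore] -/
theorem not_transportNearMonotone_at {k : ℕ} (hk : 3 ≤ k) :
    ¬ ∀ c : ℕ, ∀ ε : ℝ, 0 < ε → ∀ᶠ n : ℕ in atTop, ∀ j : ℕ, Central k n j →
      ∀ C : Circuit (Edge n), C.IsOver monotoneBasis → C.size ≤ n ^ c →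
        ∃ F : (Edge n → Bool) → Bool, Monotone F ∧ l1 n (pc n k) (ind F) (transport j (ind C.eval)) ≤ ε := by
  intro h
  obtain ⟨cw, hw⟩ := eventually_parityOn_witness
  have H := h cw (1 / 24) (by norm_num)
  obtain ⟨n, hn, hwn⟩ := (H.and (hw k hk)).exists
  obtain ⟨C, hC, hCs, hfar⟩ := hwn (thr k n) (central_thr k n)
  obtain ⟨F, hF, hd⟩ := hn (thr k n) (central_thr k n) C hC hCs
  have := hfar F hF
  linarith

end

end Summit.PneNP.PneNP.Theorems.MonotoneContinuation.Negative
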